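import Summits.AtomisticToContinuum.Crystallization.Theorems.PhononStability.Negative.Mirror

/-!
# `PhononStability` (stmt-AtomisticToContinuum-9333), negative side II: `Adm` is load-bearing

`PhononStabilityOn Inner₀` (the crux with the admissible-cell hypothesis `Adm A` deleted, i.e. the
window predicate `W t A = Inner t A` of part I) is FALSE: with `A = 0` the site set is the two points `0, e₁/40` (the inner-shift hypothesis still
holds), and the transverse displacement `e₂` at `0` has nearest-neighbour strain `2` but second
variation `40·V′(1/40) = −40¹⁴ + 40⁸ < 0` — the pure pre-stress term `V′(r)/r` of a hugely
compressed bond.  Hence no `κ > 0` works and any proof of the crux must USE `Adm` (at least to keep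
bond lengths near `0.97`).  All `[folklore]`.
-/

noncomputable section

namespace Summit.AtomisticToContinuum.Crystallization.Theorems.PhononStabilityNegative

open scoped BigOperators Topology Classical InnerProductSpace
open Filter Set Function
open Literature.MathematicalPhysics.StatisticalMechanics
open Summit.AtomisticToContinuum.Crystallization.Theses.ExcessDecayLiouville

local notation "E3" => EuclideanSpace ℝ (Fin 3)

/-! ## The witness: `A = 0`, `t = (0, e₁/40)`, `u = e₂ · 𝟙_{0}` -/

/-- Inner shift of the witness, `d = e₁/40`. [folklore] -/
def dW : E3 := EuclideanSpace.single 0 (1 / 40 : ℝ)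
/-- Transverse displacement of the witness, `w = e₂`. [folklore] -/
def wW : E3 := EuclideanSpace.single 1 (1 : ℝ)
/-- Sublattice translations of the witness. [folklore] -/
def tW : Fin 2 → E3 := ![0, dW]
/-- Displacement field of the witness: `w` at the origin, `0` elsewhere. [folklore] -/
def uW : E3 → E3 := fun p => if p = 0 then wW else 0

/-- `‖d‖ = 1/40`. [folklore] -/
theorem norm_dW : ‖dW‖ = 1 / 40 := by
  rw [dW, PiLp.norm_single, Real.norm_eq_abs, abs_of_pos (by norm_num)]

/-- `‖w‖ = 1`. [folklore] -/
theorem norm_wW : ‖wW‖ = 1 := by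
  rw [wW, PiLp.norm_single, norm_one]

/-- `d ≠ 0`. [folklore] -/
theorem dW_ne_zero : dW ≠ 0 := by
  intro h; have := norm_dW; rw [h, norm_zero] at this; norm_num at this

/-- `w ≠ 0`. [folklore] -/
theorem wW_ne_zero : wW ≠ 0 := by
  intro h; have := norm_wW; rw [h, norm_zero] at this; norm_num at this

/-- `w ⊥ d`. [folklore] -/
theorem inner_dW_wW : inner ℝ dW wW = 0 := by
  simp [dW, wW, EuclideanSpace.inner_single_left]

/-- `u 0 = w`. [folklore] -/
theorem uW_zero : uW 0 = wW := if_pos rfl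
/-- `u d = 0`. [folklore] -/
theorem uW_dW : uW dW = 0 := if_neg dW_ne_zero

/-- `u` is supported in `{0}`. [folklore] -/
theorem support_uW : Function.support uW ⊆ {0} := by
  intro p hp
  by_contra h0
  exact hp (if_neg h0)

/-- The witness site set is `{0, d}`. [folklore] -/
theorem sites₀_tW : Sites₀ tW 0 = {0, dW} := by
  rw [sites₀_zero]; rfl

/-- The witness satisfies the inner-shift hypothesis (`‖d‖ = 1/40`). [folklore] -/
theorem inner₀_tW : Inner₀ tW 0 := by
  have h : tW 1 - tW 0 - (0 : E3 →L[ℝ] E3) (barlowOffset 1 + layerNormal (Real.sqrt (2 / 3))) = dW := by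
    simp [tW]
  rw [Inner₀, h, norm_dW]

/-- Nearest-neighbour strain of the witness: `2`. [folklore] -/
theorem nnForm_witness : nnForm tW 0 uW = 2 := by
  rw [nnForm, sites₀_tW, tsum_tsum_pair dW_ne_zero.symm
    (fun p q : E3 => if dist p q ≤ 11 / 10 then ‖uW p - uW q‖ ^ 2 else 0)]
  simp only [uW_zero, uW_dW, dist_self, dist_eq_norm, zero_sub, sub_zero, norm_neg, norm_dW,
    sub_self, norm_zero, norm_wW]
  norm_num

/-- Second-variation double sum of the witness: `80·V′(1/40)·40 = 80(−40¹³ + 40⁷)`. [folklore] -/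
theorem hessForm_witness : hessForm tW 0 uW = 80 * (-(40 : ℝ) ^ 13 + 40 ^ 7) := by
  rw [hessForm, sites₀_tW, tsum_tsum_pair dW_ne_zero.symm
    (fun p q : E3 => if p ≠ q then Hess₀ (p - q) (uW p - uW q) else 0)]
  have h1 : Hess₀ (0 - dW) (wW - 0) = 40 * (-(40 : ℝ) ^ 13 + 40 ^ 7) := by
    rw [zero_sub, sub_zero, Hess₀_of_inner_eq_zero (by rw [inner_neg_left, inner_dW_wW, neg_zero]),
      norm_neg, norm_dW, norm_wW, deriv_lennardJones (by norm_num)]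
    norm_num
  have h2 : Hess₀ (dW - 0) (0 - wW) = 40 * (-(40 : ℝ) ^ 13 + 40 ^ 7) := by
    rw [zero_sub, sub_zero, Hess₀_of_inner_eq_zero (by rw [inner_neg_right, inner_dW_wW, neg_zero]),
      norm_neg, norm_dW, norm_wW, deriv_lennardJones (by norm_num)]
    norm_num
  simp only [ne_eq, not_true_eq_false, if_false, dW_ne_zero, dW_ne_zero.symm, not_false_eq_true,
    if_true, uW_zero, uW_dW, h1, h2]
  ring

/-- **`Adm` is load-bearing.** Without the admissible-cell hypothesis the degenerate cell `A = 0`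
is allowed; the site set is then the two points `0, e₁/40`, and the transverse displacement `e₂`
at the origin has nearest-neighbour strain `2` but second variation
`40·V′(1/40) = -40¹⁴ + 40⁸ < 0` (pure pre-stress term of a hugely compressed bond). Hence no
`κ > 0` works: any proof of the crux must use `Adm` (at least to keep bond lengths near `0.97`). [folklore] -/
theorem phononStability_false_without_Adm : ¬ PhononStabilityOn fun t A => Inner₀ t A := by
  intro hP
  unfold PhononStabilityOn at hP
  obtain ⟨κ, hκ, h⟩ := hP
  have key := h tW 0 inner₀_tW uW ((Set.finite_singleton (0 : E3)).subset support_uW)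
    (support_uW.trans (by
      intro p hp
      rw [Set.mem_singleton_iff] at hp
      subst hp
      exact ⟨0, 0, zero_mem_Λ₀, by simp [tW]⟩))
  rw [nnForm_witness, hessForm_witness] at key
  have h40 : (40 : ℝ) ^ 7 < 40 ^ 13 := by norm_num
  nlinarith

end Summit.AtomisticToContinuum.Crystallization.Theorems.PhononStabilityNegative

end
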